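import Mathlib
import HarnessLib
import Summits.Ventures.LatticeQCDFlow.Scaling.AcceptanceEssEightNinthsIntegralWitness

/-!
# LatticeQCDFlow / Scaling — the Gini acceptance floor `ā ≥ 1 − √((1/κ − 1)/3)` is ATTAINED on a
# general measure space, at EVERY `κ ∈ (3/4, 1]` (affine ramps on `(0, 1]`)

HONEST FRAMING: exact (Metropolis-corrected) sampling algorithms for lattice gauge theory;
figures of merit are autocorrelation/cost numbers at stated couplings and volumes; no
continuum-physics claim.

Venture `LatticeQCDFlow` (cell pub-lqcd), topic `Scaling`; FANOUT row 3 (`s0-u1-a`, S0-B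
implementation A, GEN-9).  NEW WORK of the cell, not a published result; NO definition is
introduced (the witness is written out: `μ =` Lebesgue measure restricted to `(0, 1]`, model
density `q̃ ≡ 1`, target weight `w_s(t) = 1 + s(2t − 1)` on `t > 0`, `= 1` for `t ≤ 0` so that
`w_s > 0` pointwise on `ℝ`; `0 ≤ s < 1`).  Companion of
`Scaling/AcceptanceEssEightNinthsIntegralWitness.lean` (imported for `∫₀¹ min(x, y) dy`; its linear
ramp is the end-point `s = 1`, `κ = 3/4`, where the two pieces of the envelope meet) and of the
floor itself, `Scaling/AcceptanceGiniFloorIntegral.lean` (`one_sub_sqrt_third_le_meanAccept…`,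
`three_mul_sq_sub_overlap_add_sq_le`).  On a FINITE space the Gini piece is a limit only (row 3's
`Scaling/AcceptanceGiniFloorSlopeWitness.lean`); on a general space it is attained, by the
uniform weight law on `[1 − s, 1 + s]`: `E min(B, B′) = 1 − s/3`, `Var B = s²/3`.

## What is proved (`μ = volume.restrict (Ioc 0 1)`, `q̃ ≡ 1`, `w_s` as above)

* `affRamp_admissible` (`0 ≤ s < 1`) — every hypothesis of the general-space floors holds;
* `affRamp_Z` (`Z = 1`), `affRamp_W₂` (`W₂ = 1 + s²/3`), `affRamp_overlap` (`s ≥ 0`: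
  `∫∫ min(w_s(x)q̃(y), w_s(y)q̃(x)) = 1 − s/3`);
* **`affRamp_glasser_eq`** — `3(Z − A)² + Z² = W₂`: EQUALITY in Glasser's inequality
  `three_mul_sq_sub_overlap_add_sq_le`;
* **`affRamp_meanAccept_eq_giniFloor`** — the normalised acceptance
  `∫∫ min(p(x)q̃(y), p(y)q̃(x))` (`p = w_s/Z`) EQUALS `1 − √(((Z²/W₂)⁻¹ − 1)/3)`, and
  `κ = Z²/W₂ = 1/(1 + s²/3)`: as `s` runs over `[0, 1)`, `κ` covers `(3/4, 1]`, so together with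
  the `8/9` witness the general-space envelope `max((8/9)κ, 1 − √((1/κ − 1)/3))` is attained at
  every `κ ∈ [3/4, 1]`.

NOT CLAIMED: attainment of the `8/9` piece for `κ < 3/4` under the pointwise hypothesis `w > 0`
(it needs an atom of zero target weight; only approached); any number of ours; nothing re-scored.
-/

namespace Summit.Ventures.LatticeQCDFlow.Theory2

open MeasureTheory Set

/-! ### The affine ramp on `(0, 1]`: `q ≡ 1`, `w_s(t) = 1 + s(2t − 1)` (`0 ≤ s < 1`; `= 1` off `t > 0`) -/

/-- The affine ramp is positive everywhere for `0 ≤ s < 1`. -/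
theorem affRamp_pos {s : ℝ} (hs0 : 0 ≤ s) (hs1 : s < 1) (t : ℝ) :
    0 < (if 0 < t then 1 + s * (2 * t - 1) else (1 : ℝ)) := by
  split_ifs with h
  · nlinarith
  · exact one_pos

/-- The affine ramp is measurable. -/
theorem measurable_affRamp (s : ℝ) :
    Measurable fun t : ℝ => if 0 < t then 1 + s * (2 * t - 1) else (1 : ℝ) :=
  Measurable.ite measurableSet_Ioi (measurable_const.add (measurable_const.mul
    ((measurable_const.mul measurable_id).sub measurable_const))) measurable_const

/-- **The affine ramp is admissible**: it satisfies every hypothesis of the general-space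
acceptance floors (`w, q > 0` measurable, `w` integrable, `∫ q = 1`, `W₂ < ∞`) for
`μ =` Lebesgue measure restricted to `(0, 1]`, for every `0 ≤ s < 1`. -/
theorem affRamp_admissible {s : ℝ} (hs0 : 0 ≤ s) (hs1 : s < 1) :
    (∀ t : ℝ, 0 < (if 0 < t then 1 + s * (2 * t - 1) else (1 : ℝ)))
      ∧ Measurable (fun t : ℝ => if 0 < t then 1 + s * (2 * t - 1) else (1 : ℝ))
      ∧ Integrable (fun t : ℝ => if 0 < t then 1 + s * (2 * t - 1) else (1 : ℝ))
          (volume.restrict (Ioc 0 1))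
      ∧ (∀ _t : ℝ, (0 : ℝ) < 1) ∧ Measurable (fun _ : ℝ => (1 : ℝ))
      ∧ Integrable (fun _ : ℝ => (1 : ℝ)) (volume.restrict (Ioc 0 1))
      ∧ ∫ _t, (1 : ℝ) ∂(volume.restrict (Ioc (0 : ℝ) 1)) = 1
      ∧ Integrable (fun t : ℝ => (if 0 < t then 1 + s * (2 * t - 1) else (1 : ℝ)) / 1
          * (if 0 < t then 1 + s * (2 * t - 1) else 1)) (volume.restrict (Ioc 0 1)) := by
  refine ⟨affRamp_pos hs0 hs1, measurable_affRamp s, ?_, fun _ => one_pos, measurable_const, ?_,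
    ?_, ?_⟩
  · refine IntegrableOn.congr_fun (f := fun t : ℝ => 1 + s * (2 * t - 1))
      ((continuous_const.add (continuous_const.mul ((continuous_const.mul continuous_id).sub
        continuous_const))).integrableOn_Icc.mono_set Ioc_subset_Icc_self)
      (fun t ht => ?_) measurableSet_Ioc
    show 1 + s * (2 * t - 1) = if 0 < t then 1 + s * (2 * t - 1) else 1
    rw [if_pos ht.1]
  · exact (continuous_const.integrableOn_Icc (a := (0:ℝ)) (b := 1)).mono_set Ioc_subset_Icc_self
  · rw [setIntegral_const, Real.volume_real_Ioc_of_le zero_le_one, smul_eq_mul]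
    norm_num
  · refine IntegrableOn.congr_fun (f := fun t : ℝ => (1 + s * (2 * t - 1)) / 1 * (1 + s * (2 * t - 1)))
      ((((continuous_const.add (continuous_const.mul ((continuous_const.mul continuous_id).sub
        continuous_const))).div_const 1).mul (continuous_const.add (continuous_const.mul
        ((continuous_const.mul continuous_id).sub continuous_const)))).integrableOn_Icc.mono_set
        Ioc_subset_Icc_self)
      (fun t ht => ?_) measurableSet_Ioc
    show (1 + s * (2 * t - 1)) / 1 * (1 + s * (2 * t - 1))
      = (if 0 < t then 1 + s * (2 * t - 1) else 1) / 1 * (if 0 < t then 1 + s * (2 * t - 1) else 1)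
    rw [if_pos ht.1]

/-- `Z = ∫ w_s dμ = 1`. -/
theorem affRamp_Z (s : ℝ) :
    ∫ t, (if 0 < t then 1 + s * (2 * t - 1) else (1 : ℝ)) ∂(volume.restrict (Ioc (0 : ℝ) 1)) = 1 := by
  have e : ∫ t in Ioc (0 : ℝ) 1, (if 0 < t then 1 + s * (2 * t - 1) else (1 : ℝ))
      = ∫ t in Ioc (0 : ℝ) 1, (1 + s * (2 * t - 1)) :=
    setIntegral_congr_fun measurableSet_Ioc fun t ht => by
      show (if 0 < t then 1 + s * (2 * t - 1) else (1 : ℝ)) = 1 + s * (2 * t - 1)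
      rw [if_pos ht.1]
  have e2 : (fun t : ℝ => 1 + s * (2 * t - 1)) = fun t => (1 - s) + (2 * s) * t := by
    funext t; ring
  have hi1 : IntervalIntegrable (fun _ : ℝ => (1 - s)) volume 0 1 := intervalIntegrable_const
  have hi2 : IntervalIntegrable (fun t : ℝ => (2 * s) * t) volume 0 1 :=
    (continuous_const.mul continuous_id).intervalIntegrable 0 1
  rw [e, ← intervalIntegral.integral_of_le zero_le_one, e2, intervalIntegral.integral_add hi1 hi2,
    intervalIntegral.integral_const, intervalIntegral.integral_const_mul, integral_id, smul_eq_mul]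
  ring

/-- `W₂ = ∫ (w_s/q) w_s dμ = 1 + s²/3`. -/
theorem affRamp_W₂ (s : ℝ) :
    ∫ t, (if 0 < t then 1 + s * (2 * t - 1) else (1 : ℝ)) / 1
        * (if 0 < t then 1 + s * (2 * t - 1) else 1) ∂(volume.restrict (Ioc (0 : ℝ) 1))
      = 1 + s ^ 2 / 3 := by
  have e : ∫ t in Ioc (0 : ℝ) 1, (if 0 < t then 1 + s * (2 * t - 1) else (1 : ℝ)) / 1
        * (if 0 < t then 1 + s * (2 * t - 1) else 1)
      = ∫ t in Ioc (0 : ℝ) 1, ((1 - s) ^ 2 + (4 * s * (1 - s)) * t + (4 * s ^ 2) * t ^ 2) :=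
    setIntegral_congr_fun measurableSet_Ioc fun t ht => by
      show (if 0 < t then 1 + s * (2 * t - 1) else (1 : ℝ)) / 1
          * (if 0 < t then 1 + s * (2 * t - 1) else 1)
        = (1 - s) ^ 2 + (4 * s * (1 - s)) * t + (4 * s ^ 2) * t ^ 2
      rw [if_pos ht.1]
      ring
  have hi1 : IntervalIntegrable (fun _ : ℝ => (1 - s) ^ 2) volume 0 1 := intervalIntegrable_const
  have hi2 : IntervalIntegrable (fun t : ℝ => (4 * s * (1 - s)) * t) volume 0 1 :=
    (continuous_const.mul continuous_id).intervalIntegrable 0 1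
  have hi3 : IntervalIntegrable (fun t : ℝ => (4 * s ^ 2) * t ^ 2) volume 0 1 :=
    (continuous_const.mul (continuous_pow 2)).intervalIntegrable 0 1
  rw [e, ← intervalIntegral.integral_of_le zero_le_one, intervalIntegral.integral_add (hi1.add hi2) hi3,
    intervalIntegral.integral_add hi1 hi2, intervalIntegral.integral_const,
    intervalIntegral.integral_const_mul, intervalIntegral.integral_const_mul, integral_id, integral_pow,
    smul_eq_mul]
  ring

/-- **The overlap**: `∫∫ min(w_s(x)q(y), w_s(y)q(x)) dμ dμ = 1 − s/3` for `s ≥ 0` (`w_s` is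
non-decreasing, so the kernel is `w_s(min(x, y))`, and `∫∫_{(0,1]²} min = 1/3`). -/
theorem affRamp_overlap {s : ℝ} (hs0 : 0 ≤ s) :
    ∫ x, ∫ y, min ((if 0 < x then 1 + s * (2 * x - 1) else (1 : ℝ)) * 1)
        ((if 0 < y then 1 + s * (2 * y - 1) else (1 : ℝ)) * 1)
        ∂(volume.restrict (Ioc (0 : ℝ) 1)) ∂(volume.restrict (Ioc (0 : ℝ) 1)) = 1 - s / 3 := by
  have e : ∫ x in Ioc (0 : ℝ) 1, ∫ y in Ioc (0 : ℝ) 1,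
        min ((if 0 < x then 1 + s * (2 * x - 1) else (1 : ℝ)) * 1)
          ((if 0 < y then 1 + s * (2 * y - 1) else (1 : ℝ)) * 1)
      = ∫ x in Ioc (0 : ℝ) 1, ((1 - s) + (2 * s) * (x - x ^ 2 / 2)) := by
    refine setIntegral_congr_fun measurableSet_Ioc fun x hx => ?_
    show ∫ y in Ioc (0 : ℝ) 1, min ((if 0 < x then 1 + s * (2 * x - 1) else (1 : ℝ)) * 1)
        ((if 0 < y then 1 + s * (2 * y - 1) else (1 : ℝ)) * 1) = (1 - s) + (2 * s) * (x - x ^ 2 / 2)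
    rw [← integral_min_unitInterval hx.1.le hx.2]
    have e1 : ∫ y in Ioc (0 : ℝ) 1, min ((if 0 < x then 1 + s * (2 * x - 1) else (1 : ℝ)) * 1)
          ((if 0 < y then 1 + s * (2 * y - 1) else (1 : ℝ)) * 1)
        = ∫ y in Ioc (0 : ℝ) 1, ((1 - s) + (2 * s) * min x y) := by
      refine setIntegral_congr_fun measurableSet_Ioc fun y hy => ?_
      show min ((if 0 < x then 1 + s * (2 * x - 1) else (1 : ℝ)) * 1)
          ((if 0 < y then 1 + s * (2 * y - 1) else (1 : ℝ)) * 1) = (1 - s) + (2 * s) * min x y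
      rw [if_pos hx.1, if_pos hy.1, mul_one, mul_one]
      rcases le_total x y with h | h
      · rw [min_eq_left h, min_eq_left (by nlinarith)]; ring
      · rw [min_eq_right h, min_eq_right (by nlinarith)]; ring
    have hi : IntegrableOn (fun y : ℝ => min x y) (Ioc 0 1) volume :=
      ((continuous_const.min continuous_id).integrableOn_Icc).mono_set Ioc_subset_Icc_self
    have hc : IntegrableOn (fun _ : ℝ => (1 - s)) (Ioc (0:ℝ) 1) volume :=
      (continuous_const.integrableOn_Icc (a := (0:ℝ)) (b := 1)).mono_set Ioc_subset_Icc_self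
    rw [e1, integral_add hc (hi.const_mul _), integral_const_mul, setIntegral_const,
      Real.volume_real_Ioc_of_le zero_le_one, smul_eq_mul]
    ring
  have hi1 : IntervalIntegrable (fun _ : ℝ => (1 - s)) volume 0 1 := intervalIntegrable_const
  have hi2 : IntervalIntegrable (fun x : ℝ => (2 * s) * (x - x ^ 2 / 2)) volume 0 1 :=
    (continuous_const.mul (continuous_id.sub ((continuous_pow 2).div_const 2))).intervalIntegrable 0 1
  have hi3 : IntervalIntegrable (fun x : ℝ => x) volume 0 1 := continuous_id.intervalIntegrable 0 1
  have hi4 : IntervalIntegrable (fun x : ℝ => x ^ 2 / 2) volume 0 1 :=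
    ((continuous_pow 2).div_const 2).intervalIntegrable 0 1
  rw [e, ← intervalIntegral.integral_of_le zero_le_one, intervalIntegral.integral_add hi1 hi2,
    intervalIntegral.integral_const, intervalIntegral.integral_const_mul,
    intervalIntegral.integral_sub hi3 hi4, intervalIntegral.integral_div, integral_id, integral_pow,
    smul_eq_mul]
  norm_num
  ring

/-- **GLASSER'S INEQUALITY IS AN EQUALITY for the affine ramp**: `3(Z − A)² + Z² = W₂`
(`Z = 1`, `A = 1 − s/3`, `W₂ = 1 + s²/3`) — equality in `three_mul_sq_sub_overlap_add_sq_le`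
(`Scaling/AcceptanceGiniFloorIntegral.lean`). -/
theorem affRamp_glasser_eq {s : ℝ} (hs0 : 0 ≤ s) :
    3 * ((∫ t, (if 0 < t then 1 + s * (2 * t - 1) else (1 : ℝ)) ∂(volume.restrict (Ioc (0 : ℝ) 1)))
          - ∫ x, ∫ y, min ((if 0 < x then 1 + s * (2 * x - 1) else (1 : ℝ)) * 1)
              ((if 0 < y then 1 + s * (2 * y - 1) else (1 : ℝ)) * 1)
              ∂(volume.restrict (Ioc (0 : ℝ) 1)) ∂(volume.restrict (Ioc (0 : ℝ) 1))) ^ 2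
        + (∫ t, (if 0 < t then 1 + s * (2 * t - 1) else (1 : ℝ)) ∂(volume.restrict (Ioc (0 : ℝ) 1))) ^ 2
      = ∫ t, (if 0 < t then 1 + s * (2 * t - 1) else (1 : ℝ)) / 1
          * (if 0 < t then 1 + s * (2 * t - 1) else 1) ∂(volume.restrict (Ioc (0 : ℝ) 1)) := by
  rw [affRamp_Z, affRamp_W₂, affRamp_overlap hs0]
  ring

/-- **THE GINI FLOOR IS ATTAINED**: for the affine ramp the normalised equilibrium acceptance
`ā = ∫∫ min(p(x)q(y), p(y)q(x))` (`p = w_s/Z`) EQUALS `1 − √((1/κ − 1)/3)` with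
`κ = Z²/W₂ = 1/(1 + s²/3)` — equality in `one_sub_sqrt_third_le_meanAccept_overlapForm`
(`Scaling/AcceptanceGiniFloorIntegral.lean`); as `s` ranges over `[0, 1)`, `κ` covers `(3/4, 1]`
(`κ = 3/4`, `s = 1`, is the linear ramp of `Scaling/AcceptanceEssEightNinthsIntegralWitness`, where
the two pieces of the envelope meet). -/
theorem affRamp_meanAccept_eq_giniFloor {s : ℝ} (hs0 : 0 ≤ s) :
    ∫ x, ∫ y, min ((if 0 < x then 1 + s * (2 * x - 1) else (1 : ℝ))
          / (∫ t, (if 0 < t then 1 + s * (2 * t - 1) else (1 : ℝ)) ∂(volume.restrict (Ioc (0 : ℝ) 1))) * 1)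
        ((if 0 < y then 1 + s * (2 * y - 1) else (1 : ℝ))
          / (∫ t, (if 0 < t then 1 + s * (2 * t - 1) else (1 : ℝ)) ∂(volume.restrict (Ioc (0 : ℝ) 1))) * 1)
        ∂(volume.restrict (Ioc (0 : ℝ) 1)) ∂(volume.restrict (Ioc (0 : ℝ) 1))
      = 1 - Real.sqrt (((( ∫ t, (if 0 < t then 1 + s * (2 * t - 1) else (1 : ℝ))
            ∂(volume.restrict (Ioc (0 : ℝ) 1))) ^ 2
          / ∫ t, (if 0 < t then 1 + s * (2 * t - 1) else (1 : ℝ)) / 1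
              * (if 0 < t then 1 + s * (2 * t - 1) else 1) ∂(volume.restrict (Ioc (0 : ℝ) 1)))⁻¹ - 1) / 3)
    ∧ (∫ t, (if 0 < t then 1 + s * (2 * t - 1) else (1 : ℝ)) ∂(volume.restrict (Ioc (0 : ℝ) 1))) ^ 2
        / (∫ t, (if 0 < t then 1 + s * (2 * t - 1) else (1 : ℝ)) / 1
            * (if 0 < t then 1 + s * (2 * t - 1) else 1) ∂(volume.restrict (Ioc (0 : ℝ) 1)))
      = 1 / (1 + s ^ 2 / 3) := by
  rw [affRamp_Z, affRamp_W₂]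
  refine ⟨?_, by rw [one_pow]⟩
  simp only [div_one]
  rw [affRamp_overlap hs0]
  have e : ((1 : ℝ) ^ 2 / (1 + s ^ 2 / 3))⁻¹ - 1 = s ^ 2 / 3 := by
    rw [one_pow, inv_div]
    ring
  rw [e, show s ^ 2 / 3 / 3 = (s / 3) ^ 2 by ring, Real.sqrt_sq (by positivity)]

end Summit.Ventures.LatticeQCDFlow.Theory2
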